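import Mathlib
import Literature.Geometry.DiscreteGeometry.KissingFanTriangleSets
import Literature.Geometry.DiscreteGeometry.SphericalCodeHullVertexLink
import Summits.AtomisticToContinuum.Crystallization.Theorems.GappedShellCensusShellTrichotomyStubBondHullEdge
import Summits.AtomisticToContinuum.Crystallization.Theorems.GappedShellCensusShellTrichotomyStubBondTriangleFacet
import Summits.AtomisticToContinuum.Crystallization.Theorems.GappedShellCensusFiveFoldRationingRStubFfrCensus5Aux1

/-!
# Crux `GappedShellCensus.FiveFoldRationingR` (stmt-AtomisticToContinuum-18071), line `Sketch` —
# helper for stub `stub_ffrGreedy` (registered sub-goal `stub_ffrGreedyFan`): the labelled fan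
# triangulation of a gapped twelve-shell with shell-degrees at least four, and its covering property

For a gapped twelve-tuple `t : Fin 12 → ℝ³` (norms in `[0.98, 1.02]`, pairwise distances `≥ 0.98`
and either `≤ 1.02` — a bond — or `≥ 1.26`) in which every point has AT LEAST four bonded partners,
let `u k = t k / ‖t k‖`, `X = {u k}` and let `tri` be the set of label sets `S ⊆ Fin 12` with
`S.image u ∈ fanTriSets X` (the fan-refined hull triangulation of `X`, pulled back along the
injective labelling).  Then, exactly as in the sibling crux's all-degree-four `stub_fanStruct`:
every triple of `tri` has three labels; `tri` has twenty triples; every side of a triple lies in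
exactly two triples; every bond is a side of exactly two triples; every bonded triangle is a
triple; the link of every label is connected (closure form).  NEW here is the seventh field, the
COVERING PROPERTY used by the directional spread of greedy routing: every vector of `ℝ³` is a
nonnegative combination `α u a + β u b + γ u c` of the directions of some triple `{a, b, c} ∈ tri`.

## Proof

Fields 1–6: transport along `S ↦ S.image u` of the tree's `card_eq_three_of_mem_fanTriSets`,
`card_fanTriSets`, `card_filter_fanTriSets_eq_two`, `card_filter_fanTriSets_eq_two_of_mem_hullEdges`
and `fanTriSets_link`, with geometric inputs `stub_ffrC5Interior` (`0 ∈ interior (conv X)`, degrees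
`≥ 4`), `stub_bondHullEdge`, `stub_bondTriangleFacet` — adapted line by line from
`GappedShellCensusShellTrichotomyStubFanStruct.lean` (whose transport lemmas are private).
Field 7: every `x` lies in the argmax cone of some facet normal `c` (`exists_mem_argmaxCone`), which
is the polygonal cone of the facet vertices `w 0, …, w (m−1)` (`argmaxCone_eq_polyCone`); the fan
step `polyCone (n+1) w ⊆ polyCone n w ∪ T(w 0, w (n−1), w n)` (`polyCone_succ_subset`) and the vertex
form of a trihedral cone (`setOf_orient3_inter₃_eq_apexCone`) put `x` in the cone spanned by the
vertices `w 0, w (i+1), w (i+2)` of a fan triangle `(c, i)`.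
-/

noncomputable section

namespace Summit.AtomisticToContinuum.Crystallization.Theorems

open Literature.Geometry.DiscreteGeometry
open scoped RealInnerProductSpace

/-! ### Covering: every vector lies in the cone of a fan triangle -/

/-- **Fan decomposition of a convex polygonal cone.**  For `k + 3` edge rays with all cyclically
ordered triples positively oriented, every point of `polyCone (k+3) w` lies in one of the trihedral
cones `cone (w 0, w (i+1), w (i+2))`, `i ≤ k` (the induction of `polyCone_subset_coneOver`).
[folklore] -/
theorem ffrGF_polyCone_cover (k : ℕ) :
    ∀ w : ℕ → EuclideanSpace ℝ (Fin 3),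
      (∀ i j l, i < j → j < l → l < k + 3 → 0 < orient3 (w i) (w j) (w l)) →
      ∀ x ∈ polyCone (k + 3) w, ∃ i, i ≤ k ∧ x ∈ apexCone 0 ![w 0, w (i + 1), w (i + 2)] := by
  -- adapted from `Literature.Geometry.DiscreteGeometry.polyCone_subset_coneOver`
  induction k with
  | zero =>
    intro w hw x hx
    have h012 := hw 0 1 2 (by omega) (by omega) (by omega)
    have hmem : x ∈ {x : EuclideanSpace ℝ (Fin 3) | 0 ≤ orient3 (w 1) (w 2) x} ∩
        {x | 0 ≤ orient3 (w 2) (w 0) x} ∩ {x | 0 ≤ orient3 (w 0) (w 1) x} :=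
      ⟨⟨by simpa using hx 1 (by omega), by simpa using hx 2 (by omega)⟩,
        by simpa using hx 0 (by omega)⟩
    rw [setOf_orient3_inter₃_eq_apexCone h012] at hmem
    exact ⟨0, le_rfl, hmem⟩
  | succ k ih =>
    intro w hw x hx
    rcases polyCone_succ_subset (by omega : 3 ≤ k + 3) w hx with h | h
    · obtain ⟨i, hi, hmem⟩ :=
        ih w (fun i j l hij hjl hl => hw i j l hij hjl (by omega)) x h
      exact ⟨i, by omega, hmem⟩
    · have hpos : 0 < orient3 (w 0) (w (k + 2)) (w (k + 3)) :=
        hw 0 (k + 2) (k + 3) (by omega) (by omega) (by omega)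
      rw [show k + 3 - 1 = k + 2 by omega, setOf_orient3_inter₃_eq_apexCone hpos] at h
      exact ⟨k + 1, le_rfl, h⟩

/-- **Every vector lies in the cone of some fan triangle** of the hull of a spherical code with
`0` in the interior of its hull: in the trihedral cone spanned by the vertices
`w 0, w (i+1), w (i+2)` (`w = fVert X c`) of some `(c, i) ∈ fanTriangles X`. [folklore] -/
theorem ffrGF_cover_fan {X : Finset (EuclideanSpace ℝ (Fin 3))} (hX1 : ∀ y ∈ X, ‖y‖ = 1)
    (h0 : (0 : EuclideanSpace ℝ (Fin 3)) ∈
      interior (convexHull ℝ (X : Set (EuclideanSpace ℝ (Fin 3)))))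
    (x : EuclideanSpace ℝ (Fin 3)) :
    ∃ p ∈ fanTriangles X,
      x ∈ apexCone 0 ![fVert X p.1 0, fVert X p.1 (p.2 + 1), fVert X p.1 (p.2 + 2)] := by
  obtain ⟨c, hcF, hxc⟩ := exists_mem_argmaxCone (facetNormals X) (facetNormals_nonempty h0) x
  have hc : c ≠ 0 := ne_zero_of_mem_facetNormals hX1 hcF
  rw [argmaxCone_eq_polyCone hX1 h0 hcF] at hxc
  have hm : 3 ≤ (facetAngles X c hc).card := by
    rw [card_facetAngles hX1 hc]
    exact three_le_card_tightSet hcF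
  obtain ⟨k, hk⟩ : ∃ k, (facetAngles X c hc).card = k + 3 := ⟨(facetAngles X c hc).card - 3, by omega⟩
  have hor : ∀ i j l, i < j → j < l → l < k + 3 →
      0 < orient3 (facetVertex X c hc i) (facetVertex X c hc j) (facetVertex X c hc l) :=
    fun i j l hij hjl hl => orient3_facetVertex_pos hX1 hcF hij hjl (by omega)
  have hxc' : x ∈ polyCone (k + 3) (facetVertex X c hc) := hk ▸ hxc
  obtain ⟨i, hi, hmem⟩ := ffrGF_polyCone_cover k (facetVertex X c hc) hor x hxc'
  refine ⟨(c, i), mem_fanTriangles.2 ⟨hcF, ?_⟩, ?_⟩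
  · change i + 2 < (tightSet X c).card
    rw [← card_facetAngles hX1 hc]
    omega
  · change x ∈ apexCone 0 ![fVert X c 0, fVert X c (i + 1), fVert X c (i + 2)]
    simp only [fVert_eq hc]
    exact hmem

/-! ### Transport along the labelling (adapted from the sibling crux's `stub_fanStruct`) -/

section Transport

variable {u : Fin 12 → EuclideanSpace ℝ (Fin 3)} {X : Finset (EuclideanSpace ℝ (Fin 3))}
  {tri : Finset (Finset (Fin 12))}

/-- The labelled points are points of `X`. [folklore] -/
theorem ffrGF_apply_mem (hX : X = Finset.univ.image u) (k : Fin 12) : u k ∈ X := by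
  -- adapted from `GappedShellCensusShellTrichotomyStubFanStruct` (private there); likewise below
  rw [hX]
  exact Finset.mem_image_of_mem u (Finset.mem_univ k)

/-- `X` consists of unit vectors. [folklore] -/
theorem ffrGF_norm_eq_one_of_mem (hu1 : ∀ k, ‖u k‖ = 1) (hX : X = Finset.univ.image u) :
    ∀ y ∈ X, ‖y‖ = 1 := by
  subst hX
  intro y hy
  obtain ⟨k, -, rfl⟩ := Finset.mem_image.1 hy
  exact hu1 k

/-- Distinct points of `X` have inner product `≤ 2801/5202`. [folklore] -/
theorem ffrGF_inner_le_of_mem (hhi : ∀ k l, k ≠ l → ⟪u k, u l⟫ ≤ 2801 / 5202)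
    (hX : X = Finset.univ.image u) : ∀ y ∈ X, ∀ y' ∈ X, y ≠ y' → ⟪y, y'⟫ ≤ 2801 / 5202 := by
  subst hX
  intro y hy y' hy' hne
  obtain ⟨k, -, rfl⟩ := Finset.mem_image.1 hy
  obtain ⟨l, -, rfl⟩ := Finset.mem_image.1 hy'
  exact hhi k l fun h => hne (congrArg u h)

/-- A fan triangle of `X` is the image of a label triple of `tri`. [folklore] -/
theorem ffrGF_exists_image_eq_of_mem (hX1 : ∀ y ∈ X, ‖y‖ = 1) (hX : X = Finset.univ.image u)
    (htri : ∀ S, S ∈ tri ↔ S.image u ∈ fanTriSets X) {T : Finset (EuclideanSpace ℝ (Fin 3))}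
    (hT : T ∈ fanTriSets X) : ∃ S ∈ tri, S.image u = T := by
  have hTX : T ⊆ Finset.univ.image u := hX ▸ subset_of_mem_fanTriSets hX1 hT
  obtain ⟨S, rfl⟩ := Finset.subset_univ_image_iff.1 hTX
  exact ⟨S, (htri S).2 hT, rfl⟩

/-- `S ↦ S.image u` maps `tri` onto `fanTriSets X`. [folklore] -/
theorem ffrGF_image_tri (hX1 : ∀ y ∈ X, ‖y‖ = 1) (hX : X = Finset.univ.image u)
    (htri : ∀ S, S ∈ tri ↔ S.image u ∈ fanTriSets X) :
    tri.image (Finset.image u) = fanTriSets X := by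
  ext T
  rw [Finset.mem_image]
  constructor
  · rintro ⟨S, hS, rfl⟩
    exact (htri S).1 hS
  · intro hT
    obtain ⟨S, hS, rfl⟩ := ffrGF_exists_image_eq_of_mem hX1 hX htri hT
    exact ⟨S, hS, rfl⟩

/-- Counting the triples through a label set `s` is counting the fan triangles through
`s.image u`. [folklore] -/
theorem ffrGF_card_filter_tri (hu : Function.Injective u) (hX1 : ∀ y ∈ X, ‖y‖ = 1)
    (hX : X = Finset.univ.image u) (htri : ∀ S, S ∈ tri ↔ S.image u ∈ fanTriSets X)
    (s : Finset (Fin 12)) :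
    (tri.filter fun S' => s ⊆ S').card =
      ((fanTriSets X).filter fun T => s.image u ⊆ T).card := by
  rw [← Finset.card_image_of_injective (tri.filter fun S' => s ⊆ S') (Finset.image_injective hu)]
  congr 1
  ext T
  simp only [Finset.mem_image, Finset.mem_filter]
  constructor
  · rintro ⟨S, ⟨hS, hsS⟩, rfl⟩
    exact ⟨(htri S).1 hS, Finset.image_subset_image hsS⟩
  · rintro ⟨hT, hsT⟩
    obtain ⟨S, hS, rfl⟩ := ffrGF_exists_image_eq_of_mem hX1 hX htri hT
    exact ⟨S, ⟨hS, (Finset.image_subset_image_iff hu).1 hsT⟩, rfl⟩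

/-- Field 1: every triple has three labels. [folklore] -/
theorem ffrGF_card_eq_three_of_mem_tri (hu : Function.Injective u) (hX1 : ∀ y ∈ X, ‖y‖ = 1)
    (htri : ∀ S, S ∈ tri ↔ S.image u ∈ fanTriSets X) : ∀ S ∈ tri, S.card = 3 := by
  intro S hS
  rw [← Finset.card_image_of_injective S hu]
  exact card_eq_three_of_mem_fanTriSets hX1 ((htri S).1 hS)

/-- Field 2: twenty triples. [folklore] -/
theorem ffrGF_card_tri (hu : Function.Injective u) (hX1 : ∀ y ∈ X, ‖y‖ = 1)
    (hX : X = Finset.univ.image u) (htri : ∀ S, S ∈ tri ↔ S.image u ∈ fanTriSets X)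
    (h0 : (0 : EuclideanSpace ℝ (Fin 3)) ∈
      interior (convexHull ℝ (X : Set (EuclideanSpace ℝ (Fin 3))))) :
    tri.card = 20 := by
  have h12 : X.card = 12 := by
    rw [hX, Finset.card_image_of_injective _ hu, Finset.card_univ, Fintype.card_fin]
  rw [← Finset.card_image_of_injective tri (Finset.image_injective hu),
    ffrGF_image_tri hX1 hX htri]
  exact card_fanTriSets h12 hX1 h0

/-- Field 3: every side of a triple lies in exactly two triples. [folklore] -/
theorem ffrGF_card_filter_side (hu : Function.Injective u) (hX1 : ∀ y ∈ X, ‖y‖ = 1)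
    (hX : X = Finset.univ.image u) (htri : ∀ S, S ∈ tri ↔ S.image u ∈ fanTriSets X)
    (h0 : (0 : EuclideanSpace ℝ (Fin 3)) ∈
      interior (convexHull ℝ (X : Set (EuclideanSpace ℝ (Fin 3))))) :
    ∀ S ∈ tri, ∀ s ⊆ S, s.card = 2 → (tri.filter fun S' => s ⊆ S').card = 2 := by
  intro S hS s hs h2
  rw [ffrGF_card_filter_tri hu hX1 hX htri s]
  exact card_filter_fanTriSets_eq_two hX1 h0 ((htri S).1 hS) (Finset.image_subset_image hs)
    (by rw [Finset.card_image_of_injective s hu, h2])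

/-- Field 4: a bond (cosine `≥ 2201/4802`) is a side of exactly two triples
(`stub_bondHullEdge`). [folklore] -/
theorem ffrGF_card_filter_bond (hu : Function.Injective u) (hX1 : ∀ y ∈ X, ‖y‖ = 1)
    (hX : X = Finset.univ.image u) (htri : ∀ S, S ∈ tri ↔ S.image u ∈ fanTriSets X)
    (h0 : (0 : EuclideanSpace ℝ (Fin 3)) ∈
      interior (convexHull ℝ (X : Set (EuclideanSpace ℝ (Fin 3)))))
    (hhi : ∀ k l, k ≠ l → ⟪u k, u l⟫ ≤ 2801 / 5202) {v w : Fin 12} (hvw : v ≠ w)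
    (hb : 2201 / 4802 ≤ ⟪u v, u w⟫) :
    (tri.filter fun S' => ({v, w} : Finset (Fin 12)) ⊆ S').card = 2 := by
  rw [ffrGF_card_filter_tri hu hX1 hX htri, Finset.image_insert, Finset.image_singleton]
  refine card_filter_fanTriSets_eq_two_of_mem_hullEdges hX1 h0
    (stub_bondHullEdge X hX1 (u v) (u w) (ffrGF_apply_mem hX v) (ffrGF_apply_mem hX w)
      (hu.ne hvw) (by linarith) ?_)
  intro y hy hyv hyw
  rw [hX] at hy
  obtain ⟨m, -, rfl⟩ := Finset.mem_image.1 hy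
  have h1 := hhi v m fun h => hyv (congrArg u h).symm
  have h2 := hhi w m fun h => hyw (congrArg u h).symm
  linarith

/-- Field 5: a bonded triangle is a triple (`stub_bondTriangleFacet`: it is exactly the tight
set of a facet, hence the vertex set of the fan triangle `(c₀, 0)` of that facet). [folklore] -/
theorem ffrGF_triple_mem_tri (hu : Function.Injective u) (hX1 : ∀ y ∈ X, ‖y‖ = 1)
    (hX : X = Finset.univ.image u) (htri : ∀ S, S ∈ tri ↔ S.image u ∈ fanTriSets X)
    (hhi : ∀ k l, k ≠ l → ⟪u k, u l⟫ ≤ 2801 / 5202) {a b c : Fin 12} (hab : a ≠ b)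
    (hbc : b ≠ c) (hac : a ≠ c) (kab : 2201 / 4802 ≤ ⟪u a, u b⟫)
    (kbc : 2201 / 4802 ≤ ⟪u b, u c⟫) (kac : 2201 / 4802 ≤ ⟪u a, u c⟫) :
    ({a, b, c} : Finset (Fin 12)) ∈ tri := by
  obtain ⟨c₀, hc₀, htight⟩ := stub_bondTriangleFacet X hX1 (ffrGF_inner_le_of_mem hhi hX) (u a)
    (u b) (u c) (ffrGF_apply_mem hX a) (ffrGF_apply_mem hX b) (ffrGF_apply_mem hX c) (hu.ne hab)
    (hu.ne hbc) (hu.ne hac) kab kbc kac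
  have himg : ({a, b, c} : Finset (Fin 12)).image u = {u a, u b, u c} := by
    rw [Finset.image_insert, Finset.image_insert, Finset.image_singleton]
  have h3 : (tightSet X c₀).card = 3 := by
    rw [htight, ← himg, Finset.card_image_of_injective _ hu]
    exact Finset.card_eq_three.2 ⟨a, b, c, hab, hac, hbc, rfl⟩
  have hp : (c₀, 0) ∈ fanTriangles X :=
    mem_fanTriangles.2 ⟨hc₀, by change 0 + 2 < (tightSet X c₀).card; omega⟩
  have heq : fanVerts X (c₀, 0) = tightSet X c₀ :=
    Finset.eq_of_subset_of_card_le (fanVerts_subset_tightSet hX1 hp)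
      (h3.trans (fanVerts_card hX1 hp).symm).le
  rw [htri, himg, ← htight]
  exact mem_fanTriSets.2 ⟨(c₀, 0), hp, heq⟩

/-- Field 6: the link of a label is connected (closure form), from `fanTriSets_link`.
[folklore] -/
theorem ffrGF_link_tri (hu : Function.Injective u) (hX1 : ∀ y ∈ X, ‖y‖ = 1)
    (hX : X = Finset.univ.image u) (htri : ∀ S, S ∈ tri ↔ S.image u ∈ fanTriSets X)
    (h0 : (0 : EuclideanSpace ℝ (Fin 3)) ∈
      interior (convexHull ℝ (X : Set (EuclideanSpace ℝ (Fin 3)))))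
    (v : Fin 12) (A : Finset (Finset (Fin 12))) (hA : A ⊆ tri.filter fun S => v ∈ S)
    (hne : A.Nonempty)
    (hcl : ∀ S ∈ A, ∀ S' ∈ tri, v ∈ S' → (S ∩ S').card = 2 → S' ∈ A) :
    A = tri.filter fun S => v ∈ S := by
  have key : A.image (Finset.image u) = (fanTriSets X).filter fun T => u v ∈ T := by
    refine fanTriSets_link hX1 h0 ?_ (hne.image _) ?_
    · intro T hT
      obtain ⟨S, hS, rfl⟩ := Finset.mem_image.1 hT
      obtain ⟨hS1, hS2⟩ := Finset.mem_filter.1 (hA hS)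
      exact Finset.mem_filter.2 ⟨(htri S).1 hS1, hu.mem_finset_image.2 hS2⟩
    · intro T hT T' hT' hvT' h2
      obtain ⟨S, hS, rfl⟩ := Finset.mem_image.1 hT
      obtain ⟨S', hS', rfl⟩ := ffrGF_exists_image_eq_of_mem hX1 hX htri hT'
      rw [← Finset.image_inter _ _ hu, Finset.card_image_of_injective _ hu] at h2
      exact Finset.mem_image_of_mem _ (hcl S hS S' hS' (hu.mem_finset_image.1 hvT') h2)
  refine Finset.Subset.antisymm hA fun S hS => ?_
  obtain ⟨hS1, hS2⟩ := Finset.mem_filter.1 hS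
  have hSA : S.image u ∈ A.image (Finset.image u) := by
    rw [key]
    exact Finset.mem_filter.2 ⟨(htri S).1 hS1, hu.mem_finset_image.2 hS2⟩
  obtain ⟨S₀, hS₀, he⟩ := Finset.mem_image.1 hSA
  exact Finset.image_injective hu he ▸ hS₀

/-- Field 7 (new): every vector is a nonnegative combination of the directions of some triple
(`ffrGF_cover_fan`, read through the labelling). [folklore] -/
theorem ffrGF_cover_tri (hX1 : ∀ y ∈ X, ‖y‖ = 1) (hX : X = Finset.univ.image u)
    (htri : ∀ S, S ∈ tri ↔ S.image u ∈ fanTriSets X)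
    (h0 : (0 : EuclideanSpace ℝ (Fin 3)) ∈
      interior (convexHull ℝ (X : Set (EuclideanSpace ℝ (Fin 3)))))
    (x : EuclideanSpace ℝ (Fin 3)) :
    ∃ a b c : Fin 12, ({a, b, c} : Finset (Fin 12)) ∈ tri ∧
      ∃ α β γ : ℝ, 0 ≤ α ∧ 0 ≤ β ∧ 0 ≤ γ ∧ x = α • u a + β • u b + γ • u c := by
  obtain ⟨p, hp, hmem⟩ := ffrGF_cover_fan hX1 h0 x
  have hT : fanVerts X p ∈ fanTriSets X := mem_fanTriSets.2 ⟨p, hp, rfl⟩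
  have hsub := subset_of_mem_fanTriSets hX1 hT
  have hlab : ∀ y ∈ fanVerts X p, ∃ k, u k = y := fun y hy => by
    have hyX := hsub hy
    rw [hX] at hyX
    obtain ⟨k, -, hk⟩ := Finset.mem_image.1 hyX
    exact ⟨k, hk⟩
  obtain ⟨a, ha⟩ := hlab (fVert X p.1 0) (by unfold fanVerts; simp)
  obtain ⟨b, hb⟩ := hlab (fVert X p.1 (p.2 + 1)) (by unfold fanVerts; simp)
  obtain ⟨c, hc⟩ := hlab (fVert X p.1 (p.2 + 2)) (by unfold fanVerts; simp)
  refine ⟨a, b, c, ?_, ?_⟩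
  · rw [htri, Finset.image_insert, Finset.image_insert, Finset.image_singleton, ha, hb, hc]
    exact hT
  · obtain ⟨co, hco, hx⟩ := hmem
    refine ⟨co 0, co 1, co 2, hco 0, hco 1, hco 2, ?_⟩
    rw [hx, ha, hb, hc, zero_add, Fin.sum_univ_three]
    simp only [Matrix.cons_val_zero, Matrix.cons_val_one, Matrix.cons_val_two, Matrix.head_cons,
      Matrix.tail_cons]

end Transport

/-! ### The registered sub-goal -/

/-- **Labelled fan triangulation at shell-degrees `≥ 4`, with covering** (registered sub-goal
`stub_ffrGreedyFan` of `stub_ffrGreedy`).  For a gapped twelve-tuple `t` with all shell-degrees at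
least four, the fan triangles of the hull of its radial projection, pulled back to label triples
`tri` (the abbreviations `u`, `X`, `tri` are explicit arguments with their defining equations):
three labels per triple, twenty triples, every side in exactly two triples, every bond a side of
exactly two triples, bonded triangles are triples, connected vertex links (closure form), and every
vector of `ℝ³` is a nonnegative combination of the directions of some triple. [folklore] -/
theorem stub_ffrGreedyFan (t : Fin 12 → EuclideanSpace ℝ (Fin 3))
    (hn : ∀ k, 1 - 1 / 50 ≤ ‖t k‖ ∧ ‖t k‖ ≤ 1 + 1 / 50)
    (hd : ∀ k l, k ≠ l → 1 - 1 / 50 ≤ dist (t k) (t l) ∧ (dist (t k) (t l) ≤ 1 + 1 / 50 ∨ 63 / 50 ≤ dist (t k) (t l)))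
    (h4 : ∀ k, 4 ≤ (Finset.univ.filter fun l => l ≠ k ∧ dist (t k) (t l) ≤ 1 + 1 / 50).card)
    (u : Fin 12 → EuclideanSpace ℝ (Fin 3)) (hu : u = fun k => ‖t k‖⁻¹ • t k)
    (X : Finset (EuclideanSpace ℝ (Fin 3))) (hX : X = Finset.univ.image u)
    (tri : Finset (Finset (Fin 12)))
    (htri : tri = Finset.univ.powerset.filter fun S =>
      S.image u ∈ Literature.Geometry.DiscreteGeometry.fanTriSets X) :
    (∀ S ∈ tri, S.card = 3) ∧ tri.card = 20 ∧
      (∀ S ∈ tri, ∀ s ⊆ S, s.card = 2 → (tri.filter fun S' => s ⊆ S').card = 2) ∧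
      (∀ v w, v ≠ w → dist (t v) (t w) ≤ 1 + 1 / 50 →
        (tri.filter fun S' => ({v, w} : Finset (Fin 12)) ⊆ S').card = 2) ∧
      (∀ a b c, a ≠ b → b ≠ c → a ≠ c → dist (t a) (t b) ≤ 1 + 1 / 50 → dist (t b) (t c) ≤ 1 + 1 / 50 →
        dist (t a) (t c) ≤ 1 + 1 / 50 → ({a, b, c} : Finset (Fin 12)) ∈ tri) ∧
      (∀ v, ∀ A ⊆ tri.filter (fun S => v ∈ S), A.Nonempty →
        (∀ S ∈ A, ∀ S' ∈ tri, v ∈ S' → (S ∩ S').card = 2 → S' ∈ A) → A = tri.filter fun S => v ∈ S) ∧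
      (∀ x : EuclideanSpace ℝ (Fin 3), ∃ a b c : Fin 12, ({a, b, c} : Finset (Fin 12)) ∈ tri ∧
        ∃ α β γ : ℝ, 0 ≤ α ∧ 0 ≤ β ∧ 0 ≤ γ ∧ x = α • u a + β • u b + γ • u c) := by
  have hu1 : ∀ k, ‖u k‖ = 1 := fun k => by rw [hu]; exact ffrC5_norm_normalize (hn k)
  have hhi : ∀ k l, k ≠ l → ⟪u k, u l⟫ ≤ 2801 / 5202 := fun k l hkl => by
    rw [hu]; exact ffrC5_inner_normalize_le (hn k) (hn l) (hd k l hkl).1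
  have hlo : ∀ k l, dist (t k) (t l) ≤ 1 + 1 / 50 → 2201 / 4802 ≤ ⟪u k, u l⟫ := fun k l h => by
    rw [hu]; exact ffrC5_le_inner_normalize (hn k) (hn l) h
  have huinj : Function.Injective u := by rw [hu]; exact ffrC5_normalize_injective t hn hd
  have htri' : ∀ S, S ∈ tri ↔ S.image u ∈ fanTriSets X := fun S => by
    rw [htri]
    exact Finset.mem_filter.trans (and_iff_right (Finset.mem_powerset.2 (Finset.subset_univ S)))
  have hX1 : ∀ y ∈ X, ‖y‖ = 1 := ffrGF_norm_eq_one_of_mem hu1 hX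
  have h0 : (0 : EuclideanSpace ℝ (Fin 3)) ∈
      interior (convexHull ℝ (X : Set (EuclideanSpace ℝ (Fin 3)))) := by
    rw [hX, Finset.coe_image, Finset.coe_univ, Set.image_univ, hu]
    exact stub_ffrC5Interior t hn hd h4
  exact ⟨ffrGF_card_eq_three_of_mem_tri huinj hX1 htri', ffrGF_card_tri huinj hX1 hX htri' h0,
    ffrGF_card_filter_side huinj hX1 hX htri' h0,
    fun v w hvw hb => ffrGF_card_filter_bond huinj hX1 hX htri' h0 hhi hvw (hlo v w hb),
    fun a b c hab hbc hac kab kbc kac => ffrGF_triple_mem_tri huinj hX1 hX htri' hhi hab hbc hac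
      (hlo a b kab) (hlo b c kbc) (hlo a c kac),
    ffrGF_link_tri huinj hX1 hX htri' h0, ffrGF_cover_tri hX1 hX htri' h0⟩

end Summit.AtomisticToContinuum.Crystallization.Theorems

end
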